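import Mathlib
import HarnessLib
import HarnessLib.Audit
import Summits.MatrixMultiplication.Statement
import Summits.MatrixMultiplication.MatrixMultiplication.Theorems.SesquiTensor
import Literature.Computability.AlgebraicComplexity.Coppersmith1982RapidRectangular
import Summits.MatrixMultiplication.MatrixMultiplication.Theorems.TetrahedronTensor
import HarnessLib.Audit.Status.Attr

/-!
Route: TetrahedronCarving

It suffices to show X = TetraExcessZero ∧ TetraPlusTwo for the TETRAHEDRON TENSOR T(K₄)_n
(Christandl–Vrana–Zuiddam 2019, Ex. 1.1.2: one EPR pair of size n on each of the six edges of K₄,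
regrouped at the four vertices; tree `Theorems.TetrahedronTensor.tetra`, exponent ω(K₄) = tree
`omegaTetra`): (A′) TetraExcessZero, ω(K₄) ≤ ω(2,1,2) — re-inserting the SIXTH edge into the diamond
K₄ − e (whose tensor is ⟨n², n, n²⟩ ⊗ unit in the {0,1}|2|3 grouping, exponent exactly ω(2,1,2) =
2ω(1,1/2,1); kernel `EdgePencil`) costs nothing in the exponent; and (B₁) TetraPlusTwo, ω + 2 ≤
ω(K₄) — the tetrahedron exponent exceeds ω by at least two (under ω = 2 this is the flattening bound
4 ≤ ω(K₄), so B₁ is necessary; it is the c = 1 member of the defect pencil B_c : 4 + c(ω − 2) ≤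
ω(K₄) of `EdgePencilDefectCone`, one notch below the old residual B_2 = TetraNoSaving : 2ω ≤ ω(K₄)).
Then ω + 2 ≤ ω(K₄) ≤ ω(2,1,2) = 2ω(1,1/2,1) ≤ 4 + 2s(ω − 2) with the middle-convexity chord s = (1/2
− b)/(1 − b) < 1/2, b = min(a, 1/2), ω(1,a,1) = 2 for some a > 0 (α > 0.1722, Coppersmith 1982, tree
`coppersmith1982_dualExponentAlpha_gt`) forces (1 − 2s)(ω − 2) ≤ 0, i.e. ω = 2: the deciding theorem
is `closes (hA : TetraExcessZero) (hB : TetraPlusTwo) : MatrixMultiplication` (PLUS-TWO RE-CUT, rev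
10, 2026-08-31; a 45-line real-arithmetic term over `omegaRect_convexOn_middle`,
`LottiRomani1983_homogeneous`, `coppersmith1982_dualExponentAlpha_gt`; by name it is
`EdgePencil.matrixMultiplication_of_excessZero_of_plusTwo'`, p795132). BOTH pieces are NECESSARY
(`EdgePencil.excessZero_of_matrixMultiplication`, `EdgePencil.plusTwo_of_matrixMultiplication`) and
the cut is EXACT with NO side condition
(`EdgePencil.matrixMultiplication_iff_excessZero_and_plusTwo' : ω(ℂ) = 2 ⟺ ω(K₄) ≤ ω(2,1,2) ∧ ω + 2
≤ ω(K₄)`, p795132); ATTACKED conjunct = TetraExcessZero (26697, unchanged since rev 4), DECLARED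
RESIDUAL = TetraPlusTwo (27058). History: born (rev 1–3) on the stronger attacked leaf TetraFlat,
ω(K₄) ≤ 4, with residual TetraNoSaving, 2ω ≤ ω(K₄) (CVZ19 Prop. 1.1.26 gives ω(K₄) ≤ 2ω); the EXCESS
RE-CUT (rev 4–6) dropped the famous rectangular conjunct HalfAlpha = α ≥ 1/2 from the attacked side
(`EdgePencil.tetraFlat_iff_halfAlpha_and_excessZero`); the PLUS-TWO RE-CUT (rev 9–13, 2026-08-31)
shrinks the RESIDUAL one notch, R₀ = TetraNoSaving ⟹ R₁ = TetraPlusTwo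
(`EdgePencil.plusTwo_of_tetraNoSaving`), STRICTLY on the record: the print-consistent world (ω,
ω(1,1/2,1), ω(K₄), α) = (2.37, 2.04, 4.5, 0.3214) has TetraPlusTwo ∧ ¬TetraNoSaving ∧ ω ≠ 2
(`EdgePencil.DefectWeb.plusTwo_undecided`), at zero cost in hypotheses because α > 0 is a tree
theorem (support AlphaPos 27060, `EdgePencil.alphaPos`). TetraNoSaving, TetraFlat, HalfAlpha, the
typed split TetraFlatSplit (closed, p793259), the (2,2) notch TetraSixthLeFifth and the Cone/Sesqui
comparison family are banked asides. Neither piece alone is known to give S: TetraExcessZero yields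
only ω(K₄) ≤ ω + 2 and ω(K₄) ≤ 2ω(1,1/2,1) < 4.088366 (vs the printed 4.633908, Brand et al. 2026
Thm. 48) — a print-consistent separating world (ω, ω(1,1/2,1), ω(K₄)) = (2.37, 2.04, 4.08) has A′ ∧
¬S (tribunal r1; `EdgePencil.ExcessWeb.excessZero_undecided`); TetraPlusTwo with the printed ω(K₄) <
4.633908 yields only ω < 2.633908, and every flattening/grouping certificate of it (ω + 2 ≤ 4 or ω +
2 ≤ ω(2,1,2)) is already a proof of S by the same chord. Decomposition-workshop node (decomp-mm lens
6 «barrier-complement carving»): the one root piece of this cell that lives on a 4-TENSOR, outside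
the hypothesis class of every catalogued ω-barrier (RectangularBarrier speaks only to the dropped
α-half); tribunal r1 PASS = SPLIT-WITH-RESIDUAL on the rev-6 cut (census-trib-mm-7 g1, 2026-08-30);
r2 requested on the plus-two cut. No idea card.
Lean: `Summit.MatrixMultiplication.MatrixMultiplication.Theorems.TetrahedronTensor.omegaTetra ℂ ≤
Literature.Computability.AlgebraicComplexity.omegaRect ℂ 2 1 2 ∧
Literature.Computability.AlgebraicComplexity.omega ℂ + 2 ≤
Summit.MatrixMultiplication.MatrixMultiplication.Theorems.TetrahedronTensor.omegaTetra ℂ`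

Rationale: WHY THIS LINE. Christandl–Vrana–Zuiddam (arXiv:1609.07476) introduced the exponent per edge of graph
tensors, proved τ(K_k) ≤ τ(K₃) = ω/3 by clique covers (Prop. 1.1.26) and beat it for k ≥ 4 by
genuinely k-partite constructions (Cor. 1.2.6: ω(T(K₄)) ≤ 4.63766; Brand et al. 2026 Thm. 48:
4.633908); ω = 2 forces every graph tensor to its flattening exponent. The cell's question is which
4-tensor statement is the honest ω-free half of ω = 2. The EDGE PENCIL (decomp-mm lens 6, kernels
`EdgePencilCore/Exponent/Web/Triangles/Excess/Sixth/SixthLadder`, p790354–p792035) computed the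
pencil of weighted carvings ψ(ε) = ω(2,ε,2) and split the old leaf exactly: TetraFlat ⟺ HalfAlpha ∧
TetraExcessZero, with ω = 2 ⟺ TetraExcessZero ∧ TetraNoSaving. The attack therefore sits on the
EXCESS of the sixth edge over the diamond — a comparison of T(K₄) with the rectangular product ⟨n²,
n, n²⟩ ⊗ unit that extracts no bound on ω or α by itself (worlds W1 = (2.37, 4, 4.5), W2 = (2.37,
4.1, 4.1): HalfAlpha and TetraExcessZero are independent and both undecided,
`ExcessWeb.halfAlpha_undecided` / `excessZero_undecided`). The DEFECT CONE (lens 6 g21–g22, kernels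
`EdgePencilDefectCone/Cuts/Web/PlusTwoCut/CoverCeiling`, p793419/p793456/p793422/p795132/p795130)
prices every two-leaf cut through it: with d = ω − 2, ρ = ω(2,1,2) − 4, t = ω(K₄) − 4, pencils A_k :
t ≤ kρ and B_c : 4 + c·d ≤ ω(K₄) cut (A_k → B_c → ω = 2) exactly when c > k·κ(a), κ(a) = (1 − 2a)/(1
− a), a ≤ min(α, 1/2); the rev-6 cut was (k, c) = (1, 2); either leaf weakens one notch at the price
α > 0 — and α > 0 IS a tree theorem (Coppersmith 1982, `coppersmith1982_dualExponentAlpha_gt :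
0.1722 < α`, κ(0.1722) < 0.792 < 1), so the (1,1) notch TetraExcessZero → TetraPlusTwo → S is FREE
and is the cut of record from rev 10 (PLUS-TWO RE-CUT: residual strictly weaker, attacked leaf
unchanged, no third binder); the (2,2) notch TetraSixthLeFifth → TetraNoSaving → S stays in reserve
as asides. Imported from: asymptotic spectra / graph tensors (CVZ), rectangular MM exponents
(Coppersmith 1982 α > 0.17227; Le Gall–Urrutia 2018, ω(1,1/2,1) < 2.044183; Lotti–Romani 1983
homogeneity/convexity), laser-method records (ω < 2.371339, α > 0.321334).
RANKED CRUXES. #2 TetraExcessZero (crux, ATTACKED, stmt 26697) — ω(K₄) ≤ ω(2,1,2): tags WEAKER · NEC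
(`excessZero_of_matrixMultiplication`) · ω-free · α-free · UNDECIDED (tribunal world (2.37, 2.04,
4.08)); consequence if proved: ω(K₄) ≤ 2ω(1,1/2,1) < 4.088366, news against the printed 4.633908;
attack form = the SIXTH-EDGE LADDER χ(δ) := exponent of [ℓ₀₁ < n^δ]·T(K₄)_n
(`EdgePencilSixthLadder`): rung δ = 0 is a theorem (`sixRung_zero`, χ(0) = ω(2,1,2),
definition-adjacent), TetraExcessZero ⟺ ∀ δ ∈ [0,1), χ(δ) ≤ ω(2,1,2)
(`excessZero_iff_forall_sixRung`), a rung δ gives ω(K₄) ≤ ω(2,1,2) + (1 − δ)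
(`omegaTetra_le_of_sixRung`, printed news from δ > 0.4545); first prover target = `stub_sixRung : ∃
δ > 0, omegaSix ℂ δ ≤ omegaRect ℂ 2 1 2` by border-rank/degeneration surgery absorbing the pendant
EPR_{⌈n^δ⌉}(0,1) into an optimal diamond decomposition (CZ18 Rem. 3.8) — why it might fail: any
lower bound ω(K₄) > ω(2,1,2) beyond flattening/grouping refutes it, and covers priced term by term
by MM constituents are capped at δ = 0 (`EdgePencilCoverCeiling`: inside the cover class the leaf is
summit-equivalent). #3 TetraPlusTwo (crux, DECLARED RESIDUAL, stmt 27058) — ω + 2 ≤ ω(K₄): tags NEC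
(`plusTwo_of_matrixMultiplication`; under S it is the flattening bound 4 ≤ ω(K₄)) · STRICTLY WEAKER
than the old residual TetraNoSaving (`plusTwo_of_tetraNoSaving`; world (2.37, 2.04, 4.5, 0.3214) ⊨
TetraPlusTwo ∧ ¬TetraNoSaving ∧ ω ≠ 2, `DefectWeb.plusTwo_undecided`) · UNDECIDED · threshold c = 1
not hand-picked (the natural notch inside the proved floor c ≥ 0.792,
`matrixMultiplication_iff_excessZero_and_transferGE_floor`); honest ω-relative residual,
keep-in-node, never staffed; BARRIER-IN-CLASS by the glue's own chord: a flattening certificate (ω +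
2 ≤ 4) or a grouping certificate (ω + 2 ≤ ω(2,1,2)) of it is already a proof of S, and
flattenings/groupings bound ω(K₄) below by at most max(4, ω(2,1,2))
(`TetraResidualGroupingCeiling`); today it gives only ω < 2.633908 from the printed ω(K₄) bound.
Support AlphaPos 27060 (0 < α; PROVED, `EdgePencil.alphaPos`, closable by name) is what made the
notch free; it is not a binder. Asides (banked, never staffed): TetraNoSaving 33478 (old residual,
rev 1–9), TetraFlat 33477 (old attacked leaf), HalfAlpha 26698, TetraFlatSplit 26699 ✓,
TetraSixthLeFifth 27059 ((2,2) notch), SesquiFlat/SesquiNoSaving 27189/27190 + comparison maps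
27191–27193 ✓, ConeFlat/ConeNoSaving 34047/34048 + maps 34049/34050 ✓, Assembly 33479 ✓ (records the
rev-3 implication TetraFlat → TetraNoSaving → S, still true and proved).
KILL CRITERIA. Refutation of TetraExcessZero = an asymptotic lower bound ω(K₄) > ω(2,1,2), i.e. a
genuinely 4-partite obstruction separating T(K₄)_n from ⟨n², n, n²⟩ ⊗ unit beyond every flattening
and grouping (all of which stop at max(4, ω(2,1,2))): closes the route `refuted:TetraExcessZero` and
would be a first-of-kind higher-order lower bound (informative either way). Refutation of
TetraPlusTwo = ω(K₄) < ω + 2 certified; since ω(K₄) ≥ 4 this needs ω > 2 proved — beyond present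
methods; a proof of ω > 2.633908 elsewhere kills it via Brand et al. Thm. 48 (the old residual died
already at ω > 2.317). A proof of ω = 2 moots both (both NEC). A new upper bound ω(K₄) ≤ ω(2,1,2) +
(1 − δ) is a RUNG (progress), not a kill; an upper bound ω(K₄) < (current ω record) + 2 is NOT a
refutation of B₁.
NOT DECOMPOSED YET. The surgery that should prove a rung δ > 0 (which optimal ⟨n², n, n²⟩-type
decomposition absorbs the pendant EPR pair; border rank vs. restriction; whether the CW-type
4-partite designs of CVZ19 §3 / Brand et al. §9 enter at all; joint rather than term-by-term
accounting of a cover, the one loophole of the cover ceiling) is layer-2 matter for the prover line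
on 26697; the typed two-diamond / book cover bound χ(δ) ≤ ω(2,1,2) + cδ is the expected BC3 birth
skeleton (Lines/birth.lean, owed by decomp-mm lens 6). Finite-level ranks of T(K₄)_n and of the
truncated tensors W_n^{(m)} are instruments, never items (InfimumNotMinimum). The residual is not
decomposed: its (2,2) partner TetraSixthLeFifth and the old residual TetraNoSaving stay asides; a
further residual shrink inside the proved floor (c ∈ (0.792, 1)) would be a hand-picked threshold
and is not planned.
CHEAPEST FALSIFIER. For A′: the {0,1}|2|3 grouping and all flattenings of T(K₄)_n are products of MM
tensors, so any lower-bound method at hand (substitution, slice rank, grouping) returns at most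
max(4, ω(2,1,2)) — run them on W_n^{(m)} for small n, m to confirm no cheap separation exists
(minutes; lens probes `#h21_crux_probe` CLEAN); the first genuinely informative computation is a
border-rank identity for W_n^{(2)} (one extra EPR pair of size 2 on the sixth edge) inside an
ω(2,1,2)-optimal scheme — if even m = 2 costs exponent, A′ is in trouble at δ = 0⁺. For B₁: nothing
cheap exists (every certificate is a proof of S); do not spend on it.

Novelty: Searches (2026-08-30): lit search --hybrid "graph tensor exponent per edge complete graph K4
asymptotic rank" (corpus: CVZ pages only: [corpus:paper-arxiv-1609.07476 p.3, p.7, p.9]); lit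
vsearch "asymptotic tensor rank of the tetrahedron graph tensor equals its flattening bound" (top
hit the same paper; no book treatment); lit galaxy search "exponent per edge|asymptotic rank of
graph tensors|4-clique tensor" --star all (only CVZ: [galaxy:pdf:7481919961065548600]; "graph
tensor" alone = ML noise); lit read arxiv:1609.07476 --grep (Thm 1.1.24, Def 1.1.25, Prop 1.1.26,
Problem 1.2.1, Cor 1.2.6, §1.3, Q 1.3.1–1.3.2); lit read arxiv:2602.11975 --grep
([corpus:paper-arxiv-2602.11975 p.5 Thm 1, p.17 Lemma 20 / Remark 21, p.51 Thm 48]); lit read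
arxiv:2604.18283 p.6 ([corpus:paper-arxiv-2604.18283 p.6], many-mode asymptotic rank context); lit
read arxiv:1812.06952 --grep "graph tensor|K_4" (0 hits: the irreversibility barrier paper does not
treat graph tensors); rg over the sub's 80+ Theses files, `ledger negatives --problem
MatrixMultiplication` (12 entries) and Literature/Barriers/MatrixMultiplication (98 files) for
tetra|graph tensor|K₄|4-tensor exponent statements: none (EPR/GHZ faces appear only as 3-tensor
support functionals).
Nearest prior art found: [corpus:paper-arxiv-1609.07476 p.9] CVZ19 §1.3 «if ω = 2 then τ(T(K₃)) =
τ(T(K₄)) = 2/3» and Problem 1.2.1 (is τ(T(K_k)) eventually 1/2?); [corpus:paper-arxiv-2602.11975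
p.17] BCKLOSW26 Remark 21 («ω = 2 would imply τ(3) = τ(4) =  [refs: 1609.07476, 2602.11975, 2604.18283, 1812.06952, paper-arxiv-1609.07476, arxiv:1609.07476, arxiv:2602.11975, paper-arxiv-2602.11975, arxiv:2604.18283, paper-arxiv-2604.18283, arxiv:1812.06952]

Barriers (technique_class: graph-tensor, higher-order-rank, laser-method): - technique_class: graph-tensor, higher-order-rank, laser-method
- Literature.Barriers.MatrixMultiplication.UniversalMethodBarrier: outside — the barrier (CVZ21 Thm
1.9 / Alman–Vassilevska Williams) bounds the value of ω obtainable from powers of a fixed 3-TENSOR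
intermediate via monomial/arbitrary degeneration; piece A is an upper bound on the exponent of a
4-tensor family and extracts no bound on ω at all, piece B is a lower-bound transfer; the glue uses
no intermediate tensor (order arithmetic on exponents).
- Literature.Barriers.MatrixMultiplication.IrreversibilityBarrier: outside — irreversibility i(T) of
a 3-tensor T bounds ω-upper-bounds PROVED THROUGH T; neither piece proves an ω-bound through a
tensor (A's conclusion is about ω(K₄); B's hypothesis-free form is a statement about reductions INTO
T(K₄), whose 'irreversibility' as a 4-tensor is not defined by the barrier).
- Literature.Barriers.MatrixMultiplication.UnstableTensorBarrier: does not apply — no bound on ω is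
derived from an unstable tensor; T(K₄)_n is a free/tight 4-tensor family used as the OBJECT, not as
a laser vehicle for ⟨n,n,n⟩.
- Literature.Barriers.MatrixMultiplication.LinearRankMethodBarrier: refutation-side only — killing A
needs R̃₄(T(K₄)_n) ≥ n^{4+δ}, beyond every flattening/linear-rank method (all flattenings of T(K₄)_n
are ≤ n⁴); stated openly (Killable axis 2); it does not obstruct PROVING A or B.
- Literature.Barriers.MatrixMultiplication.InfimumNotMinimumBarrier: acknowledged — ω(K₄) is an i

History (route lifecycle, newest last):
- 2026-08-30T13:59:50Z · rev 1: informal re-worded for TetraFlat (planner-decomp-mm-writer-1-g4-0)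
- 2026-08-30T14:02:40Z · rev 1: informal re-worded for TetraFlat (planner-decomp-mm-writer-1-g4-0)
- 2026-08-30T14:02:45Z · rev 1: informal re-worded for TetraFlat (planner-decomp-mm-writer-1-g4-0)
- 2026-08-30T22:24:15Z · RESIDUAL declared: TetraNoSaving (stmt-MatrixMultiplication-33478) — summit-strength until shown otherwise: EXCESS RE-CUT (rev 4–6, writer g5): TetraNoSaving (2ω ≤ ω(K₄), stmt-MatrixMultiplication-33478) is the declared RESIDUAL (planner-decomp-mm-writer-1-g5-0)
- 2026-08-31T00:16:13Z · RESIDUAL cleared: TetraNoSaving (stmt-MatrixMultiplication-33478) — flag dropped (no shrink claimed) (planner-decomp-mm-writer-1-g6-0)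
- 2026-08-31T00:17:55Z · rev 15: informal re-worded for TetraPlusTwo (planner-decomp-mm-writer-1-g6-0)
- 2026-08-31T00:18:19Z · rev 16: informal re-worded for TetraNoSaving (planner-decomp-mm-writer-1-g6-0)

sub-problem: MatrixMultiplication · status: open · opened planner-decomp-mm-writer-1-g4-0 2026-08-30T13:48:55Z · rev 17 · ledger route-MatrixMultiplication-TetrahedronCarving
GENERATED by the gate from the ledger (D-0016/17). Provers cite these decls: `theorem foo : Summit.MatrixMultiplication.MatrixMultiplication.Theses.TetrahedronCarving.<Decl> := …` in Summits/MatrixMultiplication/MatrixMultiplication/Theorems/<Name>.lean.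
-/

namespace Summit.MatrixMultiplication.MatrixMultiplication.Theses.TetrahedronCarving

open scoped BigOperators Topology Manifold Classical MeasureTheory ProbabilityTheory Matrix InnerProductSpace ComplexConjugate ContinuousMap
open Filter Set Function TopologicalSpace MeasureTheory

attribute [summit_statement] _root_.MatrixMultiplication

/-- item stmt-MatrixMultiplication-26697 · crux · rank 2 · open · by planner
why it might fail: any asymptotic lower bound ω(K₄) > ω(2,1,2) (a genuinely 4-partite obstruction beyond groupings/flattenings, e.g. a quantum-functional or support-rank separation of T(K₄) from ⟨n²,n,n²⟩ ⊗ unit) refutes it; none is in print, and every recorded lower-bound method stops at max(4, ω(2,1,2)).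
sources: ChristandlVranaZuiddam2016, arXiv:1609.07476, arXiv:1606.04085, WilliamsXuXuZhou2024
[crux, rank 2 — the ATTACKED leaf after the EXCESS RE-CUT (decomp-mm lens 6 g20 NODE §3, writer g5
decision)] ExcessZero: ω(K₄) ≤ ω(2,1,2) — «re-inserting the sixth edge into the diamond costs
nothing in the exponent»: the tetrahedron tensor T(K₄)_n (tree
`Theorems.TetrahedronTensor.tetra`/`omegaTetra` = ω(K₄)) is asymptotically no more expensive than
its own {0,1}|2|3 grouping ⟨n²,n,n²⟩ ⊗ (unit), whose exponent is the rectangular ω(2,1,2) (tree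
`Literature…omegaRect`; the grouping LOWER bound ω(2,1,2) ≤ ω(K₄) is the tree theorem
`Theorems.TetrahedronTensorRectangular.omegaRect_two_one_two_le_omegaTetra`, so the leaf says ω(K₄)
= ω(2,1,2), kernel `EdgePencil.excessZero_iff_eq`). It is the NON-RECTANGULAR CONJUNCT of the old
attacked leaf: TetraFlat (ω(K₄) ≤ 4) ⟺ HalfAlpha (α ≥ 1/2) ∧ TetraExcessZero (kernel
`EdgePencil.tetraFlat_iff_halfAlpha_and_excessZero`, p791729 Theorems/EdgePencilExcess.lean), and
the residual TetraNoSaving absorbs the rectangular half: ω = 2 ⟺ TetraExcessZero ∧ TetraNoSaving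
EXACTLY (kernel `EdgePencil.matrixMultiplication_iff_excessZero_and_tetraNoSaving`; the deciding
theorem `closes hA hB` is the one-liner through the in-closure tree theorem `Theorems.Con -/
@[route_item "route-MatrixMultiplication-TetrahedronCarving", crux (bottleneck := idea) (experiment := "instrument: istered certified experiment + ≤ 2 lenses reading it + the critic — candidates named by the cells themselves: a2c OSI blockers X_A/X_B (aft…") (source := "director FRONTIER l.46 + director FRONTIER l.146, 2026-09-01")]
def TetraExcessZero : Prop :=
  Summit.MatrixMultiplication.MatrixMultiplication.Theorems.TetrahedronTensor.omegaTetra ℂ ≤ Literature.Computability.AlgebraicComplexity.omegaRect ℂ 2 1 2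

/-- item stmt-MatrixMultiplication-27058 · crux · RESIDUAL (gen 0; summit-strength until shown otherwise, D-0170) · rank 9 · open · by planner
why it might fail: false in law-consistent defect worlds with t < d, e.g. (ω, ω(1,1/2,1), ω(K₄)) = (2.37, 2.04, 4.3); if ω > 2 it needs a lower-bound transfer ⟨m,m,m⟩-diagonal ⇝ T(K₄)_n at rate m = n beyond every flattening/grouping (those stop at max(4, ω(2,1,2))).
sources: ChristandlVranaZuiddam2016, arXiv:1609.07476, BrandEtAl2026, Coppersmith1982
[crux · DECLARED RESIDUAL R₁ (PLUS-TWO RE-CUT rev 10–13, writer g6; lens-6 g21–g22 defect cone B_1)]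
TetraPlusTwo: ω + 2 ≤ ω(K₄) — the tetrahedron exponent exceeds ω by at least two; the second binder
of the cut of record `closes (hA : TetraExcessZero) (hB : TetraPlusTwo)`. Tags NEC
(`EdgePencilDefectCuts.plusTwo_of_matrixMultiplication`; under ω = 2 it is the flattening bound 4 ≤
ω(K₄)) · WEAKER than the old residual TetraNoSaving = B_2 (`plusTwo_of_tetraNoSaving`), STRICTLY on
the record (`DefectWeb.plusTwo_undecided`: the print-consistent world (ω, ω(1,1/2,1), ω(K₄), α) =
(2.37, 2.04, 4.5, 0.3214) ⊨ B_1 ∧ ¬B_2 ∧ ω ≠ 2) · UNDECIDED · exact with the attacked leaf and NO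
side condition (`EdgePencil.matrixMultiplication_iff_excessZero_and_plusTwo'`, p795132; α > 0 is the
Literature theorem `coppersmith1982_dualExponentAlpha_gt`) · threshold c = 1 = the natural notch of
the pencil B_c : 4 + c(ω − 2) ≤ ω(K₄) inside the PROVED floor c ≥ 0.792
(`matrixMultiplication_iff_excessZero_and_transferGE_floor`), not hand-picked · leaf IDEA-NEEDED (a
lower-bound transfer ⟨m,m,m⟩ ⇝ T(K₄)_n at rate m = n, half the rate B_2 needed) · BARRIER-IN-CLASS
(a flattening certificate ω + 2 ≤ 4 or a groupin -/
@[route_item "route-MatrixMultiplication-TetrahedronCarving", crux (bottleneck := idea) (source := "ledger wanted_by.residual on stmt-MatrixMultiplication-27058, 2026-09-01")]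
def TetraPlusTwo : Prop :=
  Literature.Computability.AlgebraicComplexity.omega ℂ + 2 ≤ Summit.MatrixMultiplication.MatrixMultiplication.Theorems.TetrahedronTensor.omegaTetra ℂ

/-- item stmt-MatrixMultiplication-33477 · aside · rank 2 · open · by planner
why it might fail: 4-partite CW-type constructions saturate (CVZ19/BCKLOSW26 stall at τ ≈ 0.7723, far from 2/3); TetraFlat forces R̃₄(T) ≤ n² for EVERY side-n 4-tensor (BCKLOSW26 Lemma 20), a 4-mode asymptotic-rank conjecture that may simply be false.
sources: ChristandlVranaZuiddam2016, BrandEtAl2026, arXiv:1609.07476, arXiv:2602.11975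
[crux] Piece A (ATTACKED conjunct) — the tetrahedron tensor sits at its flattening exponent: ω(K₄) ≤
4, i.e. R₄(T(K₄)_n) = n^{4+o(1)} (equivalently τ(T(K₄)) = 2/3; kernel `omegaTetra_le_four_iff :
ω(K₄) ≤ 4 ⟺ ω(K₄) = 4`). Tag WEAKER · NEC (kernel `omegaTetra_le_four_of_matrixMultiplication`) ·
UNDECIDED-with-test (alone it gives ω(1,2,2) = 4, α ≥ 1/2, ω ≤ 12/5 — not S; kernel:
`omegaRect_one_two_two_eq_four_of_omegaTetra_le_four`,
`half_le_dualExponentAlpha_of_omegaTetra_le_four`, `omega_le_twelve_fifths_of_omegaTetra_le_four`);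
printed ladder 6 → 4.63766 (CVZ19 Cor. 1.2.6) → 4.633908 (BCKLOSW26 Thm. 48) → target 4; named open
problem: CVZ19 Question 1.3.2 at G = K₄ (decided siblings: bipartite G only, trivially; odd cycles
open, Thm. 1.1.24); leaf ATTACKABLE-IN-CLASS (4-mode laser method / surgery on an explicit family) +
INSTRUMENTABLE (finite levels R₄(T(K₄)_n) for n = 2, 3 by rank certificates). [difficulty:
open-problem] -/
@[route_item "route-MatrixMultiplication-TetrahedronCarving"]
def TetraFlat : Prop :=
  Summit.MatrixMultiplication.MatrixMultiplication.Theorems.TetrahedronTensor.omegaTetra ℂ ≤ 4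

/-- item stmt-MatrixMultiplication-33478 · aside · rank 3 · open · by planner
why it might fail: if ω > 2.317 it is FALSE outright (ω(K₄) < 4.634 < 2ω); already today the best 4-partite bound τ(K₄) < 0.772318 beats the best triangle bound ω/3 < 0.790447, i.e. current methods DO save over two triangles.
sources: ChristandlVranaZuiddam2016, BrandEtAl2026, arXiv:1609.07476
[aside — the old residual R₀ (rev 1–9), banked by the PLUS-TWO RE-CUT rev 10–13; decl never
re-worded, ≥ 6 Theorems files use it by name] Piece B — no saving over two triangles: 2ω ≤ ω(K₄)
(equivalently ω(K₄) = 2ω, kernel `two_mul_omega_le_omegaTetra_iff`, the cover ω(K₄) ≤ 2ω being the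
tree theorem `omegaTetra_le_two_mul_omega`, CVZ19 Prop. 1.1.26). The STRONGER sufficient form of the
residual of record TetraPlusTwo (`EdgePencilDefectCuts.plusTwo_of_tetraNoSaving`; strictly stronger
on the record, `DefectWeb.plusTwo_undecided`). Tags NEC
(`two_mul_omega_le_omegaTetra_of_matrixMultiplication`) · UNDECIDED-with-test (alone, with the
printed ω(K₄) < 4.633908, it gives ω < 2.316954) · exact with the attacked leaf
(`EdgePencil.matrixMultiplication_iff_excessZero_and_tetraNoSaving`, the rev 5–9 cut) and consumed
by the landed (2,2) cut `EdgePencil.matrixMultiplication_of_doubleDefect_of_tetraNoSaving'`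
(TetraSixthLeFifth → TetraNoSaving → S) · leaf IDEA-NEEDED (a lower-bound transfer ⟨m,m,m⟩ ⇝ T(K₄)_n
at rate m = n²) · BARRIER-IN-CLASS as a tree theorem
(`TetraResidualGroupingCeiling.groupingClass_certifies_residual_iff`,
`TetraDiagonal.two_mul_omega_le_omegaDiag_iff`: every grouping ce -/
@[route_item "route-MatrixMultiplication-TetrahedronCarving"]
def TetraNoSaving : Prop :=
  2 * Literature.Computability.AlgebraicComplexity.omega ℂ ≤ Summit.MatrixMultiplication.MatrixMultiplication.Theorems.TetrahedronTensor.omegaTetra ℂ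

/-- item stmt-MatrixMultiplication-26698 · aside · rank 9 · open · by planner
why it might fail: α ≥ 1/2 is far beyond the record α > 0.321334 and CW-type (T-method) designs are capped at α ≤ 0.625 by CLLZ2025; nothing in the tree or in print approaches 1/2.
sources: WilliamsXuXuZhou2024, arXiv:2307.07970, LeGall2012, Coppersmith1982
[aside — the RECTANGULAR conjunct of the old attacked leaf, recorded, never staffed] HalfAlpha: α ≥
1/2, i.e. ω(1,1/2,1) = 2, equivalently ω(2,1,2) = 4 (kernel
`EdgePencil.omegaRect_two_one_two_le_four_iff_half_le_dualExponentAlpha`; tree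
`Literature…dualExponentAlpha`, `omegaRect_eq_two_iff_le_dualExponentAlpha`). TetraFlat ⟺ HalfAlpha
∧ TetraExcessZero (kernel `tetraFlat_iff_halfAlpha_and_excessZero`); the cut of record does NOT need
it (TetraNoSaving absorbs it: `matrixMultiplication_iff_excessZero_and_tetraNoSaving`), which is the
point of the re-cut. NEC (ω = 2 ⟹ α = 1; kernel `halfAlpha_of_matrixMultiplication`) · UNDECIDED
(record α > 0.321334 [WilliamsXuXuZhou2024]; world W2 has ¬HalfAlpha:
`EdgePencil.ExcessWeb.halfAlpha_undecided`) · BC7 probe CLEAN. BARRIER PLACEMENT: INSIDE the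
rectangular-method class — `Literature/Barriers/MatrixMultiplication/RectangularBarrier*.lean`
(`CLLZ2025_alpha_barrier_CW`, `IsTMethodAlphaBound.le_dualExponentAlpha`: CW-type methods certify α
≤ 0.625; 1/2 < 0.625, so the barrier caps but does not exclude). A famous open problem in its own
right; banked as context only. -/
@[route_item "route-MatrixMultiplication-TetrahedronCarving", crux]
def HalfAlpha : Prop :=
  (1 / 2 : ℝ) ≤ Literature.Computability.AlgebraicComplexity.dualExponentAlpha ℂ

/-- item stmt-MatrixMultiplication-26699 · aside · rank 9 · closed · proved by Summit.MatrixMultiplication.MatrixMultiplication.Theorems.TetrahedronCarvingTetraFlatSplit.tetraFlatSplit_holds (prover) · by planner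
why it might fail: it cannot: both directions are the landed kernel theorem tetraFlat_iff_halfAlpha_and_excessZero (p791729).
sources: ChristandlVranaZuiddam2016, arXiv:1609.07476
[aside — DECOMPOSITION RECORD of the old attacked leaf; PROVABLE NOW] TetraFlat (ω(K₄) ≤ 4) is
exactly the conjunction of its rectangular half HalfAlpha (α ≥ 1/2 ⟺ ω(2,1,2) = 4) and its
non-rectangular half TetraExcessZero (ω(K₄) ≤ ω(2,1,2)): proof = ω(2,1,2) ≤ ω(K₄) always (grouping)
and ω(2,1,2) ≤ 4 ⟺ α ≥ 1/2. Landed as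
`Summit.MatrixMultiplication.MatrixMultiplication.Theorems.EdgePencil.tetraFlat_iff_halfAlpha_and_excessZero`
(p791729 Theorems/EdgePencilExcess.lean, decomp-mm lens 6 g20); closable by name through a one-line
bridge file (`theorem tetraFlatSplit_holds : Theses.TetrahedronCarving.TetraFlatSplit :=
EdgePencil.tetraFlat_iff_halfAlpha_and_excessZero`). Records why the re-cut is a strict weakening of
the attacked leaf and where the old leaf TetraFlat (stmt-MatrixMultiplication-33477, aside after the
re-cut; sufficient: TetraFlat ⟹ TetraExcessZero, `excessZero_of_tetraFlat`) sits. -/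
@[route_item "route-MatrixMultiplication-TetrahedronCarving"]
def TetraFlatSplit : Prop :=
  TetraFlat ↔ (HalfAlpha ∧ TetraExcessZero)

-- `TetraFlatSplit` holds: proved by `Summit.MatrixMultiplication.MatrixMultiplication.Theorems.TetrahedronCarvingTetraFlatSplit.tetraFlatSplit_holds` (its module imports this route file, so no `_holds` link can be stated here).

/-- item stmt-MatrixMultiplication-27059 · aside · rank 9 · open · by planner
why it might fail: any asymptotic lower bound ω(K₄) > 2ω(2,1,2) − 4 refutes it; in defect worlds with ρ small and t near ρ + 1 it fails (DefectWeb), and nothing in print separates T(K₄) from two diamonds.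
sources: ChristandlVranaZuiddam2016, arXiv:1609.07476, arXiv:1606.04085
[aside — DEFECT-CONE pencil A_2 (lens-6 g21 NODE-g21 §2–§4), recorded, never staffed]
TetraSixthLeFifth: ω(K₄) + 4 ≤ 2·ω(2,1,2), i.e. t ≤ 2ρ in defect coordinates (t = ω(K₄) − 4, ρ =
ω(2,1,2) − 4): «the sixth edge is no dearer than the other five» — the attacked leaf TetraExcessZero
(A_1: t ≤ ρ) weakened one notch. NEC (`doubleDefect_of_matrixMultiplication`); TetraExcessZero ⟹
TetraSixthLeFifth (`doubleDefect_of_tetraExcessZero`); strictly weaker and UNDECIDED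
(`DefectWeb.doubleDefect_undecided`); priced alternative cut (2,2): TetraSixthLeFifth →
TetraNoSaving → AlphaPos → ω = 2 (`matrixMultiplication_of_doubleDefect_of_tetraNoSaving`,
`matrixMultiplication_iff_doubleDefect_and_tetraNoSaving`); pricing theorem A_k → B_c → ω = 2
whenever c > k·κ(a), κ(a) = (1−2a)/(1−a), a ≤ min(α,1/2) (`EdgePencilDefectCone`); BC7 probe CLEAN. -/
@[route_item "route-MatrixMultiplication-TetrahedronCarving"]
def TetraSixthLeFifth : Prop :=
  Summit.MatrixMultiplication.MatrixMultiplication.Theorems.TetrahedronTensor.omegaTetra ℂ + 4 ≤ 2 * Literature.Computability.AlgebraicComplexity.omegaRect ℂ 2 1 2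

/-- item stmt-MatrixMultiplication-27060 · aside · rank 9 · closed · proved by Summit.MatrixMultiplication.MatrixMultiplication.Theorems.TetrahedronCarvingAlphaPos.alphaPos_holds (prover) · by planner
why it might fail: it cannot mathematically (Coppersmith 1982 proves α > 0.172); the only risk is formal: the Literature module stating it is unbuilt on the farm, so a by-name close may bounce rc 75 until it builds.
sources: Coppersmith1982, LeGall2012, WilliamsXuXuZhou2024
[aside — SUPPORT FACT, recorded] AlphaPos: α > 0 (Coppersmith 1982: α > 0.172; tree decl
`coppersmith1982_dualExponentAlpha_gt : 0.1722 < α` in Literature…Coppersmith1982RapidRectangular,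
module currently UNBUILT on the farm ⇒ carried as a hypothesis by the lens-6 g21 priced cuts;
becomes a close-by-name once the module builds). It is the price of either one-notch weakening (cuts
(1,1) and (2,2) of NODE-g21). -/
@[route_item "route-MatrixMultiplication-TetrahedronCarving"]
def AlphaPos : Prop :=
  0 < Literature.Computability.AlgebraicComplexity.dualExponentAlpha ℂ

-- `AlphaPos` holds: proved by `Summit.MatrixMultiplication.MatrixMultiplication.Theorems.TetrahedronCarvingAlphaPos.alphaPos_holds` (its module imports this route file, so no `_holds` link can be stated here).

/-- item stmt-MatrixMultiplication-27189 · aside · rank 9 · open · by planner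
why it might fail: it forces ω ≤ 30/13 and (via TetraFlat) α ≥ 1/2, beyond every record (ω < 2.371339, α > 0.321334); its 3-shadow ω(1,3/4,3/2) = 5/2 is CW_q-barred for all q ≥ 2 (0.75 > 0.740248), unbarred only at q = 1.
sources: ChristandlVranaZuiddam2016, arXiv:1609.07476, arXiv:2003.03019, BrandEtAl2026
[aside, BANKED node — never staffed] Piece A(3,2) of the u = 3/2 member SesquiCarving of the
spoke/rim family of exact carvings (decomp-mm lens 6 g15; carrier = the sesqui-weighted tetrahedron
S_n = CVZ19 nonuniform graph tensor T_f(K₄), f = (n³,n³,n³,n²,n²,n²) = T(K₄)_n ⊠ W_n, tree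
`Theorems.SesquiTensor.sesqui` / `omegaSesqui` =: Ω, p777809/p778052): S sits at its flattening
exponent, Ω ≤ 10. EXACTNESS in kernel: ω(ℂ) = 2 ⟺ SesquiFlat ∧ SesquiNoSaving
(`Theorems.SesquiTensor.matrixMultiplication_iff_sesqui`, SesquiTensorCut). BETWEEN the two attacked
pieces already on this route: ConeFlat ⟹ SesquiFlat (kernel
`omegaSesqui_le_ten_of_omegaCone_le_six`, item SesquiFlatOfConeFlat) and SesquiFlat ⟹ TetraFlat
(CVZ19 Prop. 2.1.7, f = (n³,n³,n³,n²,n²,n²); kernel part `omegaTetra_le_of_omegaSesqui_le_ten`: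
ω(K₄) ≤ (ω+10)/3). Alone it yields ω(6,4,3) = 10 (⟨n, n^{3/4}, n^{3/2}⟩ tight), ω ≤ 30/13 (kernel
`sesquiFlat_consequences`): its 3-shadow (t,r) = (3/4, 3/2) is NOT CW_q-barred for q = 1 (abar₁(1.5)
= 0.760381, census Table B) and barred for every q ≥ 2 — the largest spoke/rim ratio with an
unbarred shadow (u = 2: barred). Instrument: `omegaTetra_le_of_sesqui_level` (one certificate R₄( -/
@[route_item "route-MatrixMultiplication-TetrahedronCarving"]
def SesquiFlat : Prop :=
  Summit.MatrixMultiplication.MatrixMultiplication.Theorems.SesquiTensor.omegaSesqui ℂ ≤ 10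

/-- item stmt-MatrixMultiplication-27190 · aside · rank 9 · open · by planner
why it might fail: a weighted 4-partite Coppersmith–Winograd bound (CVZ19 Thm. 2.1.6 with weights (3,3,3,2,2,2)) plausibly certifies Ω < 11.857 = 5·(record ω); then it is false unless ω < Ω/5.
sources: ChristandlVranaZuiddam2016, arXiv:1609.07476, arXiv:2003.03019, BrandEtAl2026
[aside, BANKED node — never staffed] Piece B(3,2) (the u = 3/2 residual) of SesquiCarving: no saving
over the five triangles, 5ω ≤ Ω (the cover Ω ≤ ω(K₄) + ω(W) ≤ 5ω is the tree theorem
`omegaSesqui_le_five_mul_omega`, every field). NECESSARY (kernel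
`five_mul_omega_le_omegaSesqui_of_matrixMultiplication`) and BETWEEN the two residuals already on
this route: TetraNoSaving ⟹ SesquiNoSaving (kernel `sesquiNoSaving_of_tetraNoSaving`, from the rim
cover 3·ω(K₄) ≤ ω + Ω, p778052; item SesquiNoSavingOfTetraNoSaving) and SesquiNoSaving ⟹
ConeNoSaving (kernel `coneNoSaving_of_sesquiNoSaving`; item ConeNoSavingOfSesquiNoSaving). Alone it
bounds nothing; every 3-grouping lower bound is summit-strength (kernel certificate 5ω ≤ ω(6,4,3) ⟺
S, `five_mul_omega_le_omegaRect_six_four_three_iff`). Leaf IDEA-NEEDED (a genuinely 4-party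
lower-bound transfer ⟨m,m,m⟩ ⇝ S_n at m = n⁵). -/
@[route_item "route-MatrixMultiplication-TetrahedronCarving"]
def SesquiNoSaving : Prop :=
  5 * Literature.Computability.AlgebraicComplexity.omega ℂ ≤ Summit.MatrixMultiplication.MatrixMultiplication.Theorems.SesquiTensor.omegaSesqui ℂ

/-- item stmt-MatrixMultiplication-27191 · aside · rank 9 · closed · proved by Summit.MatrixMultiplication.MatrixMultiplication.Theorems.TetrahedronCarvingSesquiComparison.sesquiNoSavingOfTetraNoSaving_holds (prover) · by planner
why it might fail: it cannot: proved in the tree (p778052); listed only so the comparison map is an item of record.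
sources: ChristandlVranaZuiddam2016, arXiv:1609.07476, arXiv:2003.03019, BrandEtAl2026
[aside, PROVABLE NOW] The residual weakens along u = 1 → 3/2: TetraNoSaving ⟹ SesquiNoSaving, from
the pointwise splitting T(K₄)_{n·n²} = ⟨n,n,n⟩_rim · S_n (`tetra_cube_eq_rim_mul_sesqui`),
R₄(T(K₄)_{n·n²}) ≤ R(⟨n,n,n⟩)·R₄(S_n), hence 3·ω(K₄) ≤ ω + Ω (kernel
`Theorems.SesquiTensor.three_mul_omegaTetra_le_omega_add_omegaSesqui`,
`sesquiNoSaving_of_tetraNoSaving`, file Theorems/SesquiTensor.lean, p778052 commit 31446fe9b68f).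
Closing term: `fun h =>
Summit.MatrixMultiplication.MatrixMultiplication.Theorems.SesquiTensor.sesquiNoSaving_of_tetraNoSaving
ℂ h` (lens sketch pkg/Sketch-bank-g15.lean). -/
@[route_item "route-MatrixMultiplication-TetrahedronCarving"]
def SesquiNoSavingOfTetraNoSaving : Prop :=
  TetraNoSaving → 5 * Literature.Computability.AlgebraicComplexity.omega ℂ ≤ Summit.MatrixMultiplication.MatrixMultiplication.Theorems.SesquiTensor.omegaSesqui ℂ

-- `SesquiNoSavingOfTetraNoSaving` holds: proved by `Summit.MatrixMultiplication.MatrixMultiplication.Theorems.TetrahedronCarvingSesquiComparison.sesquiNoSavingOfTetraNoSaving_holds` (its module imports this route file, so no `_holds` link can be stated here).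

/-- item stmt-MatrixMultiplication-27192 · aside · rank 9 · closed · proved by Summit.MatrixMultiplication.MatrixMultiplication.Theorems.TetrahedronCarvingSesquiComparison.coneNoSavingOfSesquiNoSaving_holds (prover) · by planner
why it might fail: it cannot: proved in the tree (p778052); listed only so the comparison map is an item of record.
sources: ChristandlVranaZuiddam2016, arXiv:1609.07476, arXiv:2003.03019, BrandEtAl2026
[aside, PROVABLE NOW] The residual weakens along u = 3/2 → 2: SesquiNoSaving ⟹ ConeNoSaving, from
the Kronecker cover R₄(S_n) ≤ R₄(T(K₄)_n)·R₄(W_n), Ω ≤ ω(K₄) + ω(W) ≤ 2ω + ω(W) (kernel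
`Theorems.SesquiTensor.omegaSesqui_le_omegaTetra_add_omegaCone`, `coneNoSaving_of_sesquiNoSaving`,
p778052). With SesquiNoSavingOfTetraNoSaving it refines the route's item ConeNoSavingOfTetraNoSaving
(34049) into two steps. Closing term: `fun h =>
Summit.MatrixMultiplication.MatrixMultiplication.Theorems.SesquiTensor.coneNoSaving_of_sesquiNoSaving
ℂ h`. -/
@[route_item "route-MatrixMultiplication-TetrahedronCarving"]
def ConeNoSavingOfSesquiNoSaving : Prop :=
  5 * Literature.Computability.AlgebraicComplexity.omega ℂ ≤ Summit.MatrixMultiplication.MatrixMultiplication.Theorems.SesquiTensor.omegaSesqui ℂ → 3 * Literature.Computability.AlgebraicComplexity.omega ℂ ≤ Summit.MatrixMultiplication.MatrixMultiplication.Theorems.ConeTensor.omegaCone ℂ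

-- `ConeNoSavingOfSesquiNoSaving` holds: proved by `Summit.MatrixMultiplication.MatrixMultiplication.Theorems.TetrahedronCarvingSesquiComparison.coneNoSavingOfSesquiNoSaving_holds` (its module imports this route file, so no `_holds` link can be stated here).

/-- item stmt-MatrixMultiplication-27193 · aside · rank 9 · closed · proved by Summit.MatrixMultiplication.MatrixMultiplication.Theorems.TetrahedronCarvingSesquiComparison.sesquiFlatOfConeFlat_holds (prover) · by planner
why it might fail: it cannot: proved in the tree (p778052); listed only so the comparison map is an item of record.
sources: ChristandlVranaZuiddam2016, arXiv:1609.07476, arXiv:2003.03019, BrandEtAl2026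
[aside, PROVABLE NOW] The attacked piece strengthens along u = 2 → 3/2: ConeFlat ⟹ SesquiFlat, i.e.
ω(W) ≤ 6 ⟹ Ω ≤ 10, via Ω ≤ ω(K₄) + ω(W) and ConeFlat ⟹ ω(K₄) ≤ 4
(`omegaTetra_le_four_of_omegaCone_le_six`, Theorems.ConeTensorApexExponent p777128); kernel
`Theorems.SesquiTensor.omegaSesqui_le_ten_of_omegaCone_le_six` (p778052). With TetraFlatOfConeFlat
(34050) and CVZ19 Prop. 2.1.7 (SesquiFlat ⟹ TetraFlat, cited) the attacked pieces are totally
ordered ConeFlat ⟹ SesquiFlat ⟹ TetraFlat. Closing term: `fun h =>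
Summit.MatrixMultiplication.MatrixMultiplication.Theorems.SesquiTensor.omegaSesqui_le_ten_of_omegaCone_le_six
ℂ h`. -/
@[route_item "route-MatrixMultiplication-TetrahedronCarving"]
def SesquiFlatOfConeFlat : Prop :=
  Summit.MatrixMultiplication.MatrixMultiplication.Theorems.ConeTensor.omegaCone ℂ ≤ 6 → Summit.MatrixMultiplication.MatrixMultiplication.Theorems.SesquiTensor.omegaSesqui ℂ ≤ 10

-- `SesquiFlatOfConeFlat` holds: proved by `Summit.MatrixMultiplication.MatrixMultiplication.Theorems.TetrahedronCarvingSesquiComparison.sesquiFlatOfConeFlat_holds` (its module imports this route file, so no `_holds` link can be stated here).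

/-- item stmt-MatrixMultiplication-34047 · aside · rank 9 · open · by planner
why it might fail: it forces α ≥ 2/3 and ω ≤ 9/4 (records 0.321334, 2.371339), beyond everything CW_q-powers certify (CLLZ α-ceiling 0.6407); a 4-mode exponent statement this strong may simply be false.
sources: ChristandlVranaZuiddam2016, arXiv:1609.07476, BrandEtAl2026
[aside, BANKED node — never staffed] Piece A(2,1) of the s = 2 member ConeCarving of the
spoke-weight family of exact carvings (decomp-mm lens 6 g14; carrier = the squared-spoke cone W_n =
CVZ19 nonuniform graph tensor T_f(K₄), f = (n²,n²,n²,n,n,n), tree `Theorems.ConeTensor.cone` /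
`omegaCone`): the cone sits at its flattening exponent, ω(W) ≤ 6. EXACTNESS in kernel: ω(ℂ) = 2 ⟺
ConeFlat ∧ ConeNoSaving (`Theorems.ConeTensor.matrixMultiplication_iff_cone`, p776632). STRONGER
than this route's attacked piece: ConeFlat ⟹ TetraFlat (CVZ19 Prop. 2.1.7 at G = K₄, kernel
`omegaTetra_le_four_of_omegaCone_le_six`, Theorems.ConeTensorApexExponent); alone it yields exactly
ω(4,2,2) = 6, ω(1,1,2) = ω(1,2,1) = 3, α ≥ 2/3, ω ≤ 9/4 (kernel `coneFlat_consequences`) — a shadow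
beyond the CW_q rectangular barrier (CLLZ Table B r = 1: 0.640678), hence beyond every catalogued
technique class; banked, not filed as a route (critic N6¹⁴ / writer DECISION 2026-08-30). UNION
EDGE: ConeFlat ⟹ ω(1,2,1) = 3 = the hypothesis of SaturationLadder's residual SquareFromTwo.
Instruments: `omegaCone_le_of_level` (one certificate R₄(W_N) ≤ N^θ, N ≥ 2 ⟹ ω(W) ≤ θ),
`omegaCone_le_six_iff_levels`, 64 ≤ R₄(W_2) ≤ 343. -/
@[route_item "route-MatrixMultiplication-TetrahedronCarving"]
def ConeFlat : Prop :=
  Summit.MatrixMultiplication.MatrixMultiplication.Theorems.ConeTensor.omegaCone ℂ ≤ 6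

/-- item stmt-MatrixMultiplication-34048 · aside · rank 9 · open · by planner
why it might fail: a weighted 4-partite Coppersmith–Winograd bound (CVZ19 Thm. 2.1.6 with weights (2,2,2,1,1,1)) plausibly certifies ω(W) < 7.114 = 3·(record ω); then it is false unless ω < ω(W)/3.
sources: ChristandlVranaZuiddam2016, arXiv:1609.07476, BrandEtAl2026
[aside, BANKED node — never staffed] Piece B(2,1) (the s = 2 residual) of ConeCarving: no saving
over the three apex triangles, 3ω ≤ ω(W) (the cover ω(W) ≤ 3ω is the tree theorem
`omegaCone_le_three_mul_omega`, every field). NECESSARY (kernel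
`three_mul_omega_le_omegaCone_of_matrixMultiplication`) and PROVABLY WEAKER than this route's
residual: TetraNoSaving ⟹ ConeNoSaving via 2·ω(K₄) ≤ ω + ω(W) (kernel
`coneNoSaving_of_tetraNoSaving`, p776758; item ConeNoSavingOfTetraNoSaving). Alone it bounds
nothing; every 3-grouping lower bound is summit-strength (kernel certificates 3ω ≤ ω(4,2,2) ⟺ S, 2ω
≤ ω(2,1,2) ⟺ S). Leaf IDEA-NEEDED (a genuinely 4-party lower-bound transfer ⟨m,m,m⟩ ⇝ W_n at m =
n³). -/
@[route_item "route-MatrixMultiplication-TetrahedronCarving"]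
def ConeNoSaving : Prop :=
  3 * Literature.Computability.AlgebraicComplexity.omega ℂ ≤ Summit.MatrixMultiplication.MatrixMultiplication.Theorems.ConeTensor.omegaCone ℂ

/-- item stmt-MatrixMultiplication-34049 · aside · rank 9 · closed · proved by Summit.MatrixMultiplication.MatrixMultiplication.Theorems.TetrahedronCarvingConeComparison.coneNoSavingOfTetraNoSaving_holds (prover) · by planner
why it might fail: it cannot: proved in the tree (p776758); listed only so the comparison map is an item of record.
sources: ChristandlVranaZuiddam2016, arXiv:1609.07476, BrandEtAl2026
[aside, PROVABLE NOW] The residual weakens along the spoke weight s = 1 → 2: TetraNoSaving ⟹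
ConeNoSaving, from the pointwise splitting T(K₄)_{n·n} = ⟨n,n,n⟩_rim · W_n, R₄(T(K₄)_{n²}) ≤
R(⟨n,n,n⟩)·R₄(W_n), hence 2·ω(K₄) ≤ ω + ω(W) (kernel
`Theorems.ConeTensor.two_mul_omegaTetra_le_omega_add_omegaCone`, `coneNoSaving_of_tetraNoSaving`,
file Theorems/ConeTensorResidual.lean, p776758 commit 806db888755c). Closing term: `fun h =>
Theorems.ConeTensor.coneNoSaving_of_tetraNoSaving (F := ℂ) h` (writer sketch farm-checked rc 0). -/
@[route_item "route-MatrixMultiplication-TetrahedronCarving"]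
def ConeNoSavingOfTetraNoSaving : Prop :=
  TetraNoSaving → 3 * Literature.Computability.AlgebraicComplexity.omega ℂ ≤ Summit.MatrixMultiplication.MatrixMultiplication.Theorems.ConeTensor.omegaCone ℂ

-- `ConeNoSavingOfTetraNoSaving` holds: proved by `Summit.MatrixMultiplication.MatrixMultiplication.Theorems.TetrahedronCarvingConeComparison.coneNoSavingOfTetraNoSaving_holds` (its module imports this route file, so no `_holds` link can be stated here).

/-- item stmt-MatrixMultiplication-34050 · aside · rank 9 · closed · proved by Summit.MatrixMultiplication.MatrixMultiplication.Theorems.TetrahedronCarvingConeComparison.tetraFlatOfConeFlat_holds (prover) · by planner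
why it might fail: it cannot once ConeTensorApexExponent is accepted (kernel); before that only ω(K₄) ≤ 3 + ω/2 is in the tree (`omegaTetra_le_of_omegaCone_le_six`).
sources: ChristandlVranaZuiddam2016, arXiv:1609.07476, BrandEtAl2026
[aside, PROVABLE from Theorems.ConeTensorApexExponent] The attacked piece strengthens along s = 1 →
2: ConeFlat ⟹ TetraFlat, i.e. ω(W) ≤ 6 ⟹ ω(K₄) ≤ 4, via the apex symmetrisation ω(K₄) ≤ (2/3)·ω(W)
(CVZ19 Prop. 2.1.7 at G = K₄, re-proved in kernel through the four differently-apexed cones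
R₄(T(K₄)_{n⁶}) ≤ R₄(W_n)⁴: Theorems.ConeTensorApexCones p776847, ConeTensorApex p776964,
ConeTensorApexExponent `omegaTetra_le_four_of_omegaCone_le_six`). So this route's crux TetraFlat
(33477) is the first NECESSARY rung of the banked ConeFlat. Closing term: `fun h =>
Theorems.ConeTensor.omegaTetra_le_four_of_omegaCone_le_six (F := ℂ) h`. -/
@[route_item "route-MatrixMultiplication-TetrahedronCarving"]
def TetraFlatOfConeFlat : Prop :=
  Summit.MatrixMultiplication.MatrixMultiplication.Theorems.ConeTensor.omegaCone ℂ ≤ 6 → TetraFlat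

-- `TetraFlatOfConeFlat` holds: proved by `Summit.MatrixMultiplication.MatrixMultiplication.Theorems.TetrahedronCarvingConeComparison.tetraFlatOfConeFlat_holds` (its module imports this route file, so no `_holds` link can be stated here).

/-- item stmt-MatrixMultiplication-33479 · assembly · rank 1 · closed · proved by Summit.MatrixMultiplication.MatrixMultiplication.Theorems.TetrahedronTensor.matrixMultiplication_of_tetra (planner) · by planner
sources: ChristandlVranaZuiddam2016
[assembly] TetraFlat → TetraNoSaving → ω(ℂ) = 2 (squeeze 2ω ≤ ω(K₄) ≤ 4, then the flattening bound 2
≤ ω); schema-level record of the deciding theorem `closes` (same implication; provable now, and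
carried in the tree as `Theorems.TetrahedronTensor.matrixMultiplication_of_tetra` once p774967
lands). -/
@[route_item "route-MatrixMultiplication-TetrahedronCarving"]
def Assembly : Prop :=
  Summit.MatrixMultiplication.MatrixMultiplication.Theorems.TetrahedronTensor.omegaTetra ℂ ≤ 4 → 2 * Literature.Computability.AlgebraicComplexity.omega ℂ ≤ Summit.MatrixMultiplication.MatrixMultiplication.Theorems.TetrahedronTensor.omegaTetra ℂ → _root_.MatrixMultiplication

/-- `Assembly` holds: proved by `Summit.MatrixMultiplication.MatrixMultiplication.Theorems.TetrahedronTensor.matrixMultiplication_of_tetra`. -/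
theorem Assembly_holds : Assembly := _root_.Summit.MatrixMultiplication.MatrixMultiplication.Theorems.TetrahedronTensor.matrixMultiplication_of_tetra

/-! D-0027 §2.1 — DECIDING THEOREM (planner-authored via `route open/edit --closes-file`; by planner-decomp-mm-writer-1-g6-0 2026-08-31T00:09:14Z):
its hypotheses are this route's items and its conclusion the sub-problem Statement (glue_lint), and it elaborates with this file. -/

@[closes "route-MatrixMultiplication-TetrahedronCarving"] theorem closes (hA : TetraExcessZero) (hB : TetraPlusTwo) : _root_.MatrixMultiplication := by
  have hα : 0 < Literature.Computability.AlgebraicComplexity.dualExponentAlpha ℂ :=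
    lt_trans (by norm_num) (Literature.Computability.AlgebraicComplexity.coppersmith1982_dualExponentAlpha_gt ℂ)
  have hA' : Summit.MatrixMultiplication.MatrixMultiplication.Theorems.TetrahedronTensor.omegaTetra ℂ ≤ Literature.Computability.AlgebraicComplexity.omegaRect ℂ 2 1 2 := hA
  have hB' : Literature.Computability.AlgebraicComplexity.omega ℂ + 2 ≤ Summit.MatrixMultiplication.MatrixMultiplication.Theorems.TetrahedronTensor.omegaTetra ℂ := hB
  have hsup : 0 < sSup {a : ℝ | a ∈ Set.Icc (0 : ℝ) 1 ∧ Literature.Computability.AlgebraicComplexity.omegaRect ℂ 1 a 1 = 2} := hα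
  have hne : ({a : ℝ | a ∈ Set.Icc (0 : ℝ) 1 ∧ Literature.Computability.AlgebraicComplexity.omegaRect ℂ 1 a 1 = 2}).Nonempty := by
    by_contra h
    rw [Set.not_nonempty_iff_eq_empty] at h
    rw [h, Real.sSup_empty] at hsup
    exact lt_irrefl _ hsup
  obtain ⟨a, ⟨⟨ha0, ha1⟩, hfa⟩, hapos⟩ := exists_lt_of_lt_csSup hne hsup
  set b : ℝ := min a (1 / 2) with hb_def
  have hb0 : 0 < b := lt_min hapos (by norm_num)
  have hb2 : b ≤ 1 / 2 := min_le_right _ _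
  have hba : b ≤ a := min_le_left _ _
  have h1b : 0 < 1 - b := by linarith
  have hfb : Literature.Computability.AlgebraicComplexity.omegaRect ℂ 1 b 1 ≤ 2 := by
    have hm := Literature.Computability.AlgebraicComplexity.omegaRect_mono_middle ℂ
      (fun _ _ _ hm => Literature.Computability.AlgebraicComplexity.tensorRank_matMulTensor_mono₃ ℂ le_rfl hm le_rfl)
      (Literature.Computability.AlgebraicComplexity.rectAdmissibleExponents_bddBelow ℂ 1 b 1) hba
    rw [hfa] at hm
    exact hm
  have hint := Literature.Computability.AlgebraicComplexity.omegaRect_convexOn_middle.interpolation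
    Literature.Computability.AlgebraicComplexity.omegaRect_convexOn_middle_holds ℂ (k₀ := b) (k := 1 / 2) hb0.le (by linarith) hb2 (by norm_num)
  set s : ℝ := (1 / 2 - b) / (1 - b) with hs_def
  have hs0 : 0 ≤ s := div_nonneg (by linarith) h1b.le
  have hs1 : s < 1 := (div_lt_one h1b).2 (by linarith)
  have h2s : 2 * s < 1 := by
    have : 2 * s = (1 - 2 * b) / (1 - b) := by rw [hs_def]; ring
    rw [this, div_lt_one h1b]
    linarith
  have hhalf : Literature.Computability.AlgebraicComplexity.omegaRect ℂ 1 (1 / 2) 1 ≤ 2 + s * (Literature.Computability.AlgebraicComplexity.omega ℂ - 2) := by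
    have hprod := mul_le_mul_of_nonneg_right hfb (sub_nonneg.2 hs1.le)
    nlinarith [hint, hprod]
  have hhom := Literature.Computability.AlgebraicComplexity.LottiRomani1983_homogeneous ℂ (ν := 2) (x := 1) (y := 1 / 2) (z := 1)
    (by norm_num) (by norm_num) (by norm_num) (by norm_num)
  norm_num at hhom
  have hchain : Literature.Computability.AlgebraicComplexity.omega ℂ + 2 ≤ 4 + 2 * s * (Literature.Computability.AlgebraicComplexity.omega ℂ - 2) := by
    have := hB'.trans hA'
    rw [hhom] at this
    nlinarith [this, hhalf]
  have hle : Literature.Computability.AlgebraicComplexity.omega ℂ ≤ 2 := by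
    refine le_of_not_gt fun hc => ?_
    have hpos : 0 < (1 - 2 * s) * (Literature.Computability.AlgebraicComplexity.omega ℂ - 2) := mul_pos (by linarith) (by linarith)
    nlinarith [hchain, hpos]
  exact _root_.MatrixMultiplication_iff.2 (le_antisymm hle (Literature.Computability.AlgebraicComplexity.omega_two_le ℂ))

end Summit.MatrixMultiplication.MatrixMultiplication.Theses.TetrahedronCarving
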